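import Summits.AtomisticToContinuum.FouriersLaw.Theorems.OddSectorIrreversibilityOddDensityIsCorrectorResolvent
import Summits.AtomisticToContinuum.FouriersLaw.Theorems.BondHeatUncertaintyLightConeBondHeatBondCorrelation
import Literature.MathematicalPhysics.KineticTheory.LangevinChainGibbs
import Mathlib.MeasureTheory.Integral.IntegralEqImproper

/-!
# `ConeScaleCorrector` (E1), line `spatial-doob-determinacy-area`: stub S1 `stub_centredCorrector`

Registered stub of crux stmt-AtomisticToContinuum-14069: every `μ_T`-a.e. limit `u` of the finite-horizon Kubo
correctors of the equilibrium OPEN pinned chain is in `L²(μ_T)` and has mean zero (fixed `N`).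

Route. For a continuous observable `f` with `|f| ≤ C e^{ϑH}` (`0 < ϑ`, `2ϑ < 1/T`) and `μ_T(f) = 0`, the scaled
Harris bound `pinnedChain_harris_bound` gives `|P_{t⁺} f(z)| ≤ K C e^{ϑH(z)} e^{-ct}` for ALL real `t`; hence the
infinite-horizon corrector `u⋆(z) = ∫_{(0,∞)} P_t f(z) dt` exists at every `z`, is the limit of the finite-horizon
correctors `∫_{(0,τ]} P_t f(z) dt`, satisfies `|u⋆| ≤ (KC/c) e^{ϑH}` (so `u⋆ ∈ L²(gibbsMeasure)`), and has
`∫ u⋆ d(gibbsMeasure) = 0` by Fubini and kernel Gibbs invariance. Specialised to `f = J = ∑ j_i`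
(`μ_T(J) = 0`: no current at equilibrium), transferred from `gibbsMeasure` to the unnormalised weight
`μ_T = Z • gibbsMeasure`, and combined with a.e.-uniqueness of limits. `N = 0`: `J ≡ 0`, `u⋆ = 0`.
-/

noncomputable section

open MeasureTheory ProbabilityTheory Filter Topology Set
open scoped ENNReal NNReal
open Literature.MathematicalPhysics.KineticTheory.HeatConduction

namespace Summit.AtomisticToContinuum.FouriersLaw.Theorems.OddSectorIrreversibility

open Summit.AtomisticToContinuum.FouriersLaw.Theorems.SubdiffusiveBondHeat
open Summit.AtomisticToContinuum.FouriersLaw.Theorems.LightConeBondHeat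

variable {N : ℕ} {ω₂ lam β γ T : ℝ}

/-! ### The total bond current `J = ∑ j_i` -/

/-- `J = ∑ᵢ jᵢ` is continuous. [folklore] -/
theorem continuous_totalBondCurrent (ω₂ lam β γ : ℝ) (N : ℕ) :
    Continuous fun y : PhaseSpace N => ∑ i : Fin N, (pinnedChain ω₂ lam β γ).bondCurrent N i y :=
  continuous_finsetSum _ fun i _ => pinnedChain_continuous_bondCurrent ω₂ lam β γ N i

/-- `|J| ≤ N · M_N(ϑ) e^{ϑH}` for every `ϑ > 0`. [folklore] -/
theorem abs_totalBondCurrent_le_exp (hω : 0 ≤ ω₂) (hl : 0 ≤ lam) (hβ : 0 ≤ β) (γ : ℝ) (N : ℕ) {ϑ : ℝ}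
    (hϑ : 0 < ϑ) (y : PhaseSpace N) :
    |∑ i : Fin N, (pinnedChain ω₂ lam β γ).bondCurrent N i y| ≤
      (N * (N * ((3 + β) / 2) * (2 * Real.exp ϑ / ϑ ^ 2))) *
        Real.exp (ϑ * (pinnedChain ω₂ lam β γ).hamiltonian N y) := by
  calc |∑ i : Fin N, (pinnedChain ω₂ lam β γ).bondCurrent N i y|
      ≤ ∑ i : Fin N, |(pinnedChain ω₂ lam β γ).bondCurrent N i y| := Finset.abs_sum_le_sum_abs _ _
    _ ≤ ∑ _i : Fin N, (N * ((3 + β) / 2) * (2 * Real.exp ϑ / ϑ ^ 2)) *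
          Real.exp (ϑ * (pinnedChain ω₂ lam β γ).hamiltonian N y) :=
        Finset.sum_le_sum fun i _ => pinnedChain_abs_bondCurrent_le_exp hω hl hβ γ N hϑ i y
    _ = _ := by rw [Finset.sum_const, Finset.card_univ, Fintype.card_fin, nsmul_eq_mul]; ring

/-- **No current at equilibrium**, summed: `∫ J d(gibbsMeasure) = 0`. [folklore] -/
theorem integral_totalBondCurrent_gibbsMeasure (hω : 0 < ω₂) (hl : 0 ≤ lam) (hβ : 0 ≤ β) (γ : ℝ) (N : ℕ)
    (hT : 0 < T) :
    ∫ y, (∑ i : Fin N, (pinnedChain ω₂ lam β γ).bondCurrent N i y) ∂((pinnedChain ω₂ lam β γ).gibbsMeasure N T) =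
      0 := by
  rw [integral_finsetSum _ (fun i _ => (pinnedChain ω₂ lam β γ).integrable_gibbsMeasure
    (pinnedChain_integrable_bondCurrent_mul_gibbsDensity hω hl hβ γ N hT i))]
  exact Finset.sum_eq_zero fun i _ => pinnedChain_integral_bondCurrent_gibbsMeasure ω₂ lam β γ N T i

/-! ### The infinite-horizon corrector of a centred nice observable -/

/-- `z ↦ ∫_{(0,∞)} P_{t⁺} f(z) dt` is (strongly) measurable for measurable `f`. [folklore] -/
theorem pinnedChain_stronglyMeasurable_corrector (hω : 0 < ω₂) (hl : 0 ≤ lam) (hβ : 0 ≤ β) (hγ : 0 ≤ γ)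
    (T_L T_R : ℝ) {f : PhaseSpace N → ℝ} (hf : Measurable f) :
    StronglyMeasurable fun z : PhaseSpace N => ∫ t in Ioi (0 : ℝ),
      ∫ y, f y ∂((pinnedChain ω₂ lam β γ).transitionKernel N T_L T_R t.toNNReal z) :=
  StronglyMeasurable.integral_prod_left' (μ := volume.restrict (Ioi (0 : ℝ)))
    (pinnedChain_stronglyMeasurable_act_uncurry hω hl hβ hγ T_L T_R hf)

section Centred

variable {ϑ K c C : ℝ} {f : PhaseSpace N → ℝ} (hK : 0 ≤ K)
  (hb : ∀ (z : PhaseSpace N) (t : ℝ≥0) (f : PhaseSpace N → ℝ), Continuous f →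
    ∀ C : ℝ, 0 ≤ C → (∀ y, |f y| ≤ C * Real.exp (ϑ * (pinnedChain ω₂ lam β γ).hamiltonian N y)) →
    |(∫ y, f y ∂((pinnedChain ω₂ lam β γ).transitionKernel N T T t z)) -
        ∫ y, f y ∂((pinnedChain ω₂ lam β γ).gibbsMeasure N T)| ≤
      K * C * Real.exp (ϑ * (pinnedChain ω₂ lam β γ).hamiltonian N z) * Real.exp (-c * t))
  (hc : 0 < c) (hf : Continuous f) (hC : 0 ≤ C)
  (hfb : ∀ y, |f y| ≤ C * Real.exp (ϑ * (pinnedChain ω₂ lam β γ).hamiltonian N y))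
  (hf0 : ∫ y, f y ∂((pinnedChain ω₂ lam β γ).gibbsMeasure N T) = 0)
include hK hb hc hf hC hfb hf0

/-- For a centred nice `f` (`μ_T(f) = 0`): `|P_{t⁺} f(z)| ≤ K C e^{ϑH(z)} e^{-ct}` for ALL real `t`
(for `t ≤ 0` the clamp `t⁺ = 0` and `e^{-ct} ≥ 1`). [folklore] -/
theorem centred_abs_act_le (z : PhaseSpace N) (t : ℝ) :
    |∫ y, f y ∂((pinnedChain ω₂ lam β γ).transitionKernel N T T t.toNNReal z)| ≤
      K * C * Real.exp (ϑ * (pinnedChain ω₂ lam β γ).hamiltonian N z) * Real.exp (-c * t) := by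
  have h := hb z t.toNNReal f hf C hC hfb
  rw [hf0, sub_zero] at h
  refine h.trans (mul_le_mul_of_nonneg_left (Real.exp_le_exp.2 ?_) (by positivity))
  rw [Real.coe_toNNReal']
  exact mul_le_mul_of_nonpos_left (le_max_left t 0) (neg_nonpos.2 hc.le)

/-- The corrector integrand `t ↦ P_{t⁺} f(z)` of a centred nice `f` is integrable on `(0, ∞)`. [folklore] -/
theorem centred_integrableOn_act (hω : 0 < ω₂) (hl : 0 ≤ lam) (hβ : 0 ≤ β) (hγ : 0 ≤ γ) (z : PhaseSpace N) :
    IntegrableOn (fun t : ℝ => ∫ y, f y ∂((pinnedChain ω₂ lam β γ).transitionKernel N T T t.toNNReal z))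
      (Ioi 0) := by
  have hmeas : AEStronglyMeasurable
      (fun t : ℝ => ∫ y, f y ∂((pinnedChain ω₂ lam β γ).transitionKernel N T T t.toNNReal z))
      (volume.restrict (Ioi 0)) :=
    ((pinnedChain_stronglyMeasurable_act_uncurry hω hl hβ hγ T T hf.measurable).comp_measurable
      (measurable_id.prodMk measurable_const : Measurable fun t : ℝ => (t, z))).aestronglyMeasurable
  refine Integrable.mono' ((exp_neg_integrableOn_Ioi 0 hc).const_mul
    (K * C * Real.exp (ϑ * (pinnedChain ω₂ lam β γ).hamiltonian N z))) hmeas (Eventually.of_forall fun t => ?_)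
  rw [Real.norm_eq_abs]
  exact centred_abs_act_le hK hb hc hf hC hfb hf0 z t

/-- **The finite-horizon correctors of a centred nice `f` converge at EVERY point** to
`u⋆(z) = ∫_{(0,∞)} P_t f(z) dt`. [folklore] -/
theorem centred_tendsto_corrector (hω : 0 < ω₂) (hl : 0 ≤ lam) (hβ : 0 ≤ β) (hγ : 0 ≤ γ) (z : PhaseSpace N) :
    Tendsto (fun τ : ℝ => ∫ t in Ioc (0 : ℝ) τ,
        ∫ y, f y ∂((pinnedChain ω₂ lam β γ).transitionKernel N T T t.toNNReal z)) atTop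
      (𝓝 (∫ t in Ioi (0 : ℝ), ∫ y, f y ∂((pinnedChain ω₂ lam β γ).transitionKernel N T T t.toNNReal z))) := by
  refine (intervalIntegral_tendsto_integral_Ioi 0 (centred_integrableOn_act hK hb hc hf hC hfb hf0 hω hl hβ hγ z)
    tendsto_id).congr' ?_
  filter_upwards [eventually_ge_atTop (0 : ℝ)] with τ hτ
  exact intervalIntegral.integral_of_le hτ

/-- `|u⋆(z)| ≤ (K C / c) e^{ϑH(z)}`. [folklore] -/
theorem centred_abs_corrector_le (z : PhaseSpace N) :
    |∫ t in Ioi (0 : ℝ), ∫ y, f y ∂((pinnedChain ω₂ lam β γ).transitionKernel N T T t.toNNReal z)| ≤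
      K * C / c * Real.exp (ϑ * (pinnedChain ω₂ lam β γ).hamiltonian N z) := by
  set B := K * C * Real.exp (ϑ * (pinnedChain ω₂ lam β γ).hamiltonian N z) with hB
  have hbound : ∀ᵐ t ∂(volume.restrict (Ioi (0 : ℝ))),
      ‖∫ y, f y ∂((pinnedChain ω₂ lam β γ).transitionKernel N T T t.toNNReal z)‖ ≤ B * Real.exp (-c * t) :=
    Eventually.of_forall fun t => by
      rw [Real.norm_eq_abs]; exact centred_abs_act_le hK hb hc hf hC hfb hf0 z t
  have hI : Integrable (fun t : ℝ => B * Real.exp (-c * t)) (volume.restrict (Ioi 0)) :=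
    (exp_neg_integrableOn_Ioi 0 hc).const_mul B
  have h := norm_integral_le_of_norm_le hI hbound
  have hexp : ∫ t in Ioi (0 : ℝ), Real.exp (-c * t) = 1 / c := by
    simpa only [neg_mul] using integral_exp_neg_mul_Ioi hc
  rw [Real.norm_eq_abs, integral_const_mul, hexp] at h
  calc _ ≤ B * (1 / c) := h
    _ = _ := by rw [hB]; ring

/-- `u⋆ ∈ L²(gibbsMeasure)` when moreover `2ϑ < 1/T` (`(u⋆)² ≤ (KC/c)² e^{2ϑH} ∈ L¹`). [folklore] -/
theorem centred_memLp_corrector (hω : 0 < ω₂) (hl : 0 ≤ lam) (hβ : 0 ≤ β) (hγ : 0 ≤ γ) (hT : 0 < T)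
    (h2ϑ : 2 * ϑ < 1 / T) :
    MemLp (fun z => ∫ t in Ioi (0 : ℝ), ∫ y, f y ∂((pinnedChain ω₂ lam β γ).transitionKernel N T T t.toNNReal z))
      2 ((pinnedChain ω₂ lam β γ).gibbsMeasure N T) := by
  have hsm := pinnedChain_stronglyMeasurable_corrector (N := N) hω hl hβ hγ T T hf.measurable
  rw [memLp_two_iff_integrable_sq hsm.aestronglyMeasurable]
  refine ((pinnedChain_integrable_exp_mul_hamiltonian_gibbsMeasure hω hl hβ γ N hT h2ϑ).const_mul
    ((K * C / c) ^ 2)).mono' (hsm.measurable.pow_const 2).aestronglyMeasurable (Eventually.of_forall fun z => ?_)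
  rw [norm_pow, Real.norm_eq_abs]
  calc |∫ t in Ioi (0 : ℝ), ∫ y, f y ∂((pinnedChain ω₂ lam β γ).transitionKernel N T T t.toNNReal z)| ^ 2
      ≤ (K * C / c * Real.exp (ϑ * (pinnedChain ω₂ lam β γ).hamiltonian N z)) ^ 2 :=
        pow_le_pow_left₀ (abs_nonneg _) (centred_abs_corrector_le hK hb hc hf hC hfb hf0 z) 2
    _ = (K * C / c) ^ 2 * Real.exp (2 * ϑ * (pinnedChain ω₂ lam β γ).hamiltonian N z) := by
        rw [mul_pow, sq (Real.exp _), ← Real.exp_add]; congr 1; ring_nf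

/-- `(z, t) ↦ P_{t⁺} f(z)` is integrable on `gibbsMeasure ⊗ Lebesgue|_{(0,∞)}` (dominated by
`K C e^{ϑH(z)} · e^{-ct}`, `ϑ < 1/T`). [folklore] -/
theorem centred_integrable_act_prod (hω : 0 < ω₂) (hl : 0 ≤ lam) (hβ : 0 ≤ β) (hγ : 0 ≤ γ) (hT : 0 < T)
    (hϑ1 : ϑ < 1 / T) :
    Integrable (Function.uncurry fun (z : PhaseSpace N) (t : ℝ) =>
        ∫ y, f y ∂((pinnedChain ω₂ lam β γ).transitionKernel N T T t.toNNReal z))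
      (((pinnedChain ω₂ lam β γ).gibbsMeasure N T).prod (volume.restrict (Ioi (0 : ℝ)))) := by
  have hmeas : AEStronglyMeasurable (Function.uncurry fun (z : PhaseSpace N) (t : ℝ) =>
        ∫ y, f y ∂((pinnedChain ω₂ lam β γ).transitionKernel N T T t.toNNReal z))
      (((pinnedChain ω₂ lam β γ).gibbsMeasure N T).prod (volume.restrict (Ioi (0 : ℝ)))) :=
    ((pinnedChain_stronglyMeasurable_act_uncurry hω hl hβ hγ T T hf.measurable).comp_measurable
      measurable_swap).aestronglyMeasurable
  have hdom : Integrable (fun q : PhaseSpace N × ℝ =>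
      (K * C * Real.exp (ϑ * (pinnedChain ω₂ lam β γ).hamiltonian N q.1)) * Real.exp (-c * q.2))
      (((pinnedChain ω₂ lam β γ).gibbsMeasure N T).prod (volume.restrict (Ioi (0 : ℝ)))) :=
    ((pinnedChain_integrable_exp_mul_hamiltonian_gibbsMeasure hω hl hβ γ N hT hϑ1).const_mul (K * C)).mul_prod
      (exp_neg_integrableOn_Ioi 0 hc)
  refine hdom.mono' hmeas (Eventually.of_forall fun q => ?_)
  rw [Real.norm_eq_abs]
  exact centred_abs_act_le hK hb hc hf hC hfb hf0 q.1 q.2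

/-- **`∫ u⋆ d(gibbsMeasure) = 0`** (Fubini + kernel Gibbs invariance + `μ_T(f) = 0`). [folklore] -/
theorem centred_integral_corrector (hω : 0 < ω₂) (hl : 0 ≤ lam) (hβ : 0 ≤ β) (hγ : 0 ≤ γ) (hN : 0 < N)
    (hT : 0 < T) (hϑ1 : ϑ < 1 / T) :
    ∫ z, (∫ t in Ioi (0 : ℝ), ∫ y, f y ∂((pinnedChain ω₂ lam β γ).transitionKernel N T T t.toNNReal z))
      ∂((pinnedChain ω₂ lam β γ).gibbsMeasure N T) = 0 := by
  haveI := pinnedChain_isProbabilityMeasure_gibbsMeasure hω hl hβ γ N hT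
  have hfi : Integrable f ((pinnedChain ω₂ lam β γ).gibbsMeasure N T) :=
    integrable_of_abs_le_exp (pinnedChain_integrable_exp_mul_hamiltonian_gibbsMeasure hω hl hβ γ N hT hϑ1) hf hfb
  rw [integral_integral_swap (centred_integrable_act_prod hK hb hc hf hC hfb hf0 hω hl hβ hγ hT hϑ1)]
  have hinner : ∀ t : ℝ, ∫ z, (∫ y, f y ∂((pinnedChain ω₂ lam β γ).transitionKernel N T T t.toNNReal z))
      ∂((pinnedChain ω₂ lam β γ).gibbsMeasure N T) = 0 := fun t => by
    rw [pinnedChain_integral_transitionKernel_gibbsMeasure hω hl hβ hγ hN hT _ hfi, hf0]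
  simp only [hinner, integral_zero]

end Centred

/-! ### The centred corrector of the total current -/

/-- **S1 against the Gibbs probability measure** (`N ≥ 1`): the infinite-horizon Kubo corrector
`u⋆ = ∫_{(0,∞)} P_t J dt` of `J = ∑ jᵢ` is in `L²(gibbsMeasure)`, has mean zero, and is the pointwise limit
of the finite-horizon correctors. [folklore] -/
theorem centredCorrector_gibbsMeasure (hω : 0 < ω₂) (hl : 0 ≤ lam) (hβ : 0 < β) (hγ : 0 < γ) (hN : 0 < N)
    (hT : 0 < T) :
    MemLp (fun z => ∫ t in Ioi (0 : ℝ), ∫ y, (∑ i : Fin N, (pinnedChain ω₂ lam β γ).bondCurrent N i y)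
        ∂((pinnedChain ω₂ lam β γ).transitionKernel N T T t.toNNReal z)) 2
      ((pinnedChain ω₂ lam β γ).gibbsMeasure N T) ∧
    ∫ z, (∫ t in Ioi (0 : ℝ), ∫ y, (∑ i : Fin N, (pinnedChain ω₂ lam β γ).bondCurrent N i y)
        ∂((pinnedChain ω₂ lam β γ).transitionKernel N T T t.toNNReal z))
      ∂((pinnedChain ω₂ lam β γ).gibbsMeasure N T) = 0 ∧
    ∀ z, Tendsto (fun τ : ℝ => ∫ t in Ioc (0 : ℝ) τ,
        ∫ y, (∑ i : Fin N, (pinnedChain ω₂ lam β γ).bondCurrent N i y)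
          ∂((pinnedChain ω₂ lam β γ).transitionKernel N T T t.toNNReal z)) atTop
      (𝓝 (∫ t in Ioi (0 : ℝ), ∫ y, (∑ i : Fin N, (pinnedChain ω₂ lam β γ).bondCurrent N i y)
        ∂((pinnedChain ω₂ lam β γ).transitionKernel N T T t.toNNReal z))) := by
  obtain ⟨hϑ0, h2ϑ⟩ := quarter_inv_temp_admissible hT
  have hϑ1 : 1 / (4 * T) < 1 / T := by linarith
  obtain ⟨K, c, hK, hc, hb⟩ := pinnedChain_harris_bound hω hl hβ hγ hN hT hϑ0 hϑ1
  have hJc := continuous_totalBondCurrent ω₂ lam β γ N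
  have hJb := abs_totalBondCurrent_le_exp hω.le hl hβ.le γ N hϑ0
  have hJ0 := integral_totalBondCurrent_gibbsMeasure hω hl hβ.le γ N hT
  have hC : (0 : ℝ) ≤ N * (N * ((3 + β) / 2) * (2 * Real.exp (1 / (4 * T)) / (1 / (4 * T)) ^ 2)) := by
    have := hβ.le
    positivity
  exact ⟨centred_memLp_corrector hK.le hb hc hJc hC hJb hJ0 hω hl hβ.le hγ.le hT h2ϑ,
    centred_integral_corrector hK.le hb hc hJc hC hJb hJ0 hω hl hβ.le hγ.le hN hT hϑ1,
    fun z => centred_tendsto_corrector hK.le hb hc hJc hC hJb hJ0 hω hl hβ.le hγ.le z⟩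

/-- For every `N` (including `N = 0`, where `J ≡ 0`): a centred `L²(gibbsMeasure)` function `v` to which the
finite-horizon correctors converge at every point. [folklore] -/
theorem exists_centredCorrector_gibbsMeasure (hω : 0 < ω₂) (hl : 0 ≤ lam) (hβ : 0 < β) (hγ : 0 < γ) (N : ℕ)
    (hT : 0 < T) :
    ∃ v : PhaseSpace N → ℝ, MemLp v 2 ((pinnedChain ω₂ lam β γ).gibbsMeasure N T) ∧
      ∫ z, v z ∂((pinnedChain ω₂ lam β γ).gibbsMeasure N T) = 0 ∧
      ∀ z, Tendsto (fun τ : ℝ => ∫ t in Ioc (0 : ℝ) τ,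
          ∫ y, (∑ i : Fin N, (pinnedChain ω₂ lam β γ).bondCurrent N i y)
            ∂((pinnedChain ω₂ lam β γ).transitionKernel N T T t.toNNReal z)) atTop (𝓝 (v z)) := by
  rcases Nat.eq_zero_or_pos N with rfl | hN
  · refine ⟨fun _ => 0, MemLp.zero', by simp, fun z => ?_⟩
    simp only [Finset.univ_eq_empty, Finset.sum_empty, integral_zero]
    exact tendsto_const_nhds
  · exact ⟨_, centredCorrector_gibbsMeasure hω hl hβ hγ hN hT⟩

/-- The unnormalised Gibbs weight is `Z • gibbsMeasure`. [folklore] -/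
theorem withDensity_exp_neg_hamiltonian_eq_smul_gibbsMeasure (hω : 0 < ω₂) (hl : 0 ≤ lam) (hβ : 0 ≤ β) (γ : ℝ)
    (N : ℕ) (hT : 0 < T) :
    (volume.withDensity fun x : PhaseSpace N =>
        ENNReal.ofReal (Real.exp (-((pinnedChain ω₂ lam β γ).hamiltonian N x) / T))) =
      (pinnedChain ω₂ lam β γ).partitionFunction N T • (pinnedChain ω₂ lam β γ).gibbsMeasure N T := by
  have hint := pinnedChain_integrable_gibbsDensity hω hl hβ γ N hT
  rw [(pinnedChain ω₂ lam β γ).gibbsMeasure_eq_smul_withDensity hint, smul_smul,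
    ENNReal.mul_inv_cancel ((pinnedChain ω₂ lam β γ).partitionFunction_ne_zero
      (pinnedChain_continuous_gibbsDensity ω₂ lam β γ N T)) ((pinnedChain ω₂ lam β γ).partitionFunction_ne_top hint),
    one_smul]
  rfl

/-- stub S1 (fixed `N`, L): every `μ_T`-a.e. limit `u` of the finite-horizon Kubo correctors
`τ ↦ ∫_{(0,τ]} P_t J_tot (x) dt` (equilibrium kernels `transitionKernel N T T`) is in `L²(μ_T)` and has
`∫ u dμ_T = 0` (`μ_T = e^{-H_N/T}·Lebesgue`, unnormalised). Proof: `μ_T = Z • gibbsMeasure`; the correctors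
converge EVERYWHERE to the centred `L²` function `u⋆` of `exists_centredCorrector_gibbsMeasure`, so `u = u⋆`
`μ_T`-a.e. by uniqueness of limits. [folklore] -/
theorem stub_centredCorrector :
    ∀ ω₂ lam β γ : ℝ, 0 < ω₂ → 0 < lam → 0 < β → 0 < γ → ∀ T : ℝ, 0 < T →
    ∀ (N : ℕ) (u : PhaseSpace N → ℝ),
    (∀ᵐ x ∂(volume.withDensity fun x : PhaseSpace N =>
        ENNReal.ofReal (Real.exp (-((pinnedChain ω₂ lam β γ).hamiltonian N x) / T))),
      Tendsto (fun τ : ℝ => ∫ t in Set.Ioc (0 : ℝ) τ,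
          ∫ y, (∑ i : Fin N, (pinnedChain ω₂ lam β γ).bondCurrent N i y)
            ∂((pinnedChain ω₂ lam β γ).transitionKernel N T T t.toNNReal x)) atTop (𝓝 (u x))) →
    MemLp u 2 (volume.withDensity fun x : PhaseSpace N =>
        ENNReal.ofReal (Real.exp (-((pinnedChain ω₂ lam β γ).hamiltonian N x) / T))) ∧
    ∫ x, u x ∂(volume.withDensity fun x : PhaseSpace N =>
        ENNReal.ofReal (Real.exp (-((pinnedChain ω₂ lam β γ).hamiltonian N x) / T))) = 0 := by
  intro ω₂ lam β γ hω hl hβ hγ T hT N u hu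
  rw [withDensity_exp_neg_hamiltonian_eq_smul_gibbsMeasure hω hl.le hβ.le γ N hT] at hu ⊢
  obtain ⟨v, hv2, hv0, hvt⟩ := exists_centredCorrector_gibbsMeasure hω hl.le hβ hγ N hT
  have hZtop := (pinnedChain ω₂ lam β γ).partitionFunction_ne_top
    (pinnedChain_integrable_gibbsDensity hω hl.le hβ.le γ N hT)
  have hae : u =ᵐ[(pinnedChain ω₂ lam β γ).partitionFunction N T • (pinnedChain ω₂ lam β γ).gibbsMeasure N T] v := by
    filter_upwards [hu] with x hx using tendsto_nhds_unique hx (hvt x)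
  refine ⟨(hv2.smul_measure hZtop).ae_eq hae.symm, ?_⟩
  rw [integral_congr_ae hae, integral_smul_measure, hv0, smul_zero]

end Summit.AtomisticToContinuum.FouriersLaw.Theorems.OddSectorIrreversibility
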